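import Summits.BirchSwinnertonDyer.BirchSwinnertonDyer.Theorems.AlignedTransportAtTwoMainConjectureOfRankZeroBSDAtTwoHalfDescentLayerIndexGrowth
import Summits.BirchSwinnertonDyer.BirchSwinnertonDyer.Theorems.AlignedTransportAtTwoMainConjectureOfRankZeroBSDAtTwoHalfDescentLayerIndexBounded
import HarnessLib

/-!
# Route `AlignedTransportAtTwo`, crux C2 `MainConjectureOfRankZeroBSDAtTwo` (stmt-BirchSwinnertonDyer-22298):
# THE GROWTH NUMBER WITHOUT GREENBERG 4.14, III — SELMER CURRENCY AND FINITE LEVEL: `0 < #Sel_{p^∞}(E/K_∞)^{Γ_{n+1}} < p^{pⁿ(p−1)} · #Sel_∞^{Γ_n}` at ANY ONE layer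
# ⟹ `μ(X(E/K_∞)) = 0`; `p^{pⁿ(p−1)μ} · #Sel_∞^{Γ_n} ∣ #Sel_∞^{Γ_{n+1}}`; finite level `0 < #Sel_{n+1}·#ker g_{n+1}·#ker h_n < p^{pⁿ(p−1)}·#Sel_n·#ker g_n ⟹ μ = 0`; completeness

HONEST FRAMING (cell `bsd-f1-sign2`, WIDTH-5 attached prover seat `bsd-line-att-p5` gen 56 on line `birth` of the lead `bsd-line-att-p2`;
`--supports` stmt-BirchSwinnertonDyer-22298, closes nothing; BSD is NOT proved by any of this; the crux C2, its verdict «blocked-on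
`Rank1Residual.GreenbergMuConjectureIrreducible`» and every registered stub (P / T / Kμ / LimDoor / MuIneqʳ / PFμ⁺) are untouched). THEOREMS ONLY — no `def`,
no instance, no named fact, no `sorry`. Route-independent (any number field `K`, any `ℤ_p`-extension `κ`, any Pontryagin-dual datum `D`). Sequel of this gen's
`…HalfDescentLayerIndexGrowth` (module form: `#(X/ω_{n+1}X) = #(X/ω_nX)·g_n`, `p^{pⁿ(p−1)μ(X)} ∣ g_n ∣ #(X/Ψ_nX)`, the ratio certificate) composed with g40/g54's
Pontryagin identification `#(X/ω_nX) = #Sel_{p^∞}(E/K_∞)^{Γ_n}` (`…LayerIndexSelmer`), gen 55's completeness (`…LayerIndexCriterion`) and the tree's control count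
`WeierstrassCurve.natCard_selmerInvariants_mul_natCard_ker_layerToInfty` (Greenberg's Lemma 4.3: `#Sel_∞^{Γ_m}·#ker h_m = #Sel_m·#ker g_m`, unconditional).

THE POINT.
* §1 (module, completeness) ★★ `muInvariant_eq_zero_iff_exists_natCard_growth_pos_lt`: **`μ(X) = 0 ⟺ ∃ n, 0 < g_n < p^{pⁿ(p−1)}`** for EVERY f.g. torsion `X` — the
  growth-number certificate of file I is COMPLETE (gen 55's layer-quotient criterion + `g_n ∣ #(X/Ψ_nX)`).
* §2 (Selmer) `natCard_selmerInvariants_succ_eq_mul_growth`: **`#Sel_∞^{Γ_{n+1}} = #Sel_∞^{Γ_n} · g_n`** for EVERY datum (no hypothesis);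
  ★★ `pow_mul_natCard_selmerInvariants_dvd_succ`: **`p^{pⁿ(p−1)·μ} · #Sel_∞^{Γ_n} ∣ #Sel_∞^{Γ_{n+1}}`** and `pow_mul_natCard_selmerInvariants_zero_dvd`:
  **`p^{(pⁿ−1)μ} · #Sel_∞^{Γ} ∣ #Sel_∞^{Γ_n}`** (`X` f.g. torsion) — with `μ ≥ 1` the invariants are multiplied by at least `p^{pⁿ(p−1)}` at EVERY step;
  ★★★ `mu_eq_zero_of_natCard_selmerInvariants_succ_pos_lt_mul`: **`0 < #Sel_∞^{Γ_{n+1}} < p^{pⁿ(p−1)} · #Sel_∞^{Γ_n}` at ANY ONE `n` ⟹ `μ(X(E/K_∞)) = 0`** — one step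
  of sub-maximal growth; gen 55's `0 < #Sel_∞^{Γ_{n+1}} < p^{pⁿ(p−1)}` is the special case; ★★ `mu_eq_zero_iff_exists_natCard_selmerInvariants_succ_pos_lt_mul`: in a
  rank-`0` tower (`f(0) ≠ 0`, `Ψ_m ∤ f`) the ratio certificate is COMPLETE.
* §3 (finite level) ★★★ `mu_eq_zero_of_natCard_selmerLayer_succ_mul_lt_mul`: **`0 < #Sel_{p^∞}(E/K_{n+1})·#ker g_{n+1}` and
  `#Sel_{p^∞}(E/K_{n+1})·#ker g_{n+1}·#ker h_n < p^{pⁿ(p−1)}·#Sel_{p^∞}(E/K_n)·#ker g_n` ⟹ `μ = 0`** (`ker g_m = A_m/Sel_m` Greenberg's control kernel — finite,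
  locally bounded by Lemma 3.3; `ker h_m` the kernel of `Sel_m → Sel_∞^{Γ_m}`); `…_fixedPoints`: with `E(K_∞)[p^∞]` finite, `#ker h_m = #E[p^∞]^{Gal(K̄/K_m)}` and the
  certificate reads **`#Sel_{n+1}·#ker g_{n+1}·#E(K_n)[p^∞] < p^{pⁿ(p−1)}·#Sel_n·#ker g_n·#E(K_{n+1})[p^∞]`**.
Reading for C2 (`p = 2`, `W/ℚ`, `ℚ_m = ℚ(ζ_{2^{m+2}})⁺`): `μ₂(X(W/ℚ_∞)) = 0` — the seed's only non-print input — is certified by ONE STEP of the tower at which the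
`2^∞`-Selmer data grow by LESS than the maximal factor `2^{2ⁿ}`; for the lineage's anchors (`λ_an = 2`) the expected step factor under MC is `4`, so the step `2 → 3`
(`4 < 16`) is the first eligible one. Sequel `…GrowthSeed` composes with the seed p583329. What is NOT claimed: no such number is computed here for any curve.
Memo `Cruxes/MainConjectureOfRankZeroBSDAtTwo/LAYER-GROWTH-att-p5-g56.md`.

References: R. Greenberg, LNM 1716 (1999), §1 pp. 60–65, Thm. 1.10, Conj. 1.11, §3 Lemmas 3.1–3.3, §4 Lemma 4.3 (p. 103) [GreenbergLNM1716]; B. Mazur, Invent. Math. 18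
(1972) §6 [Mazur1972]; L. Washington, GTM 83, §13.3 Thm. 13.13 [Washington1997]; T. Fukuda, Proc. Japan Acad. 70 (1994) [Fukuda1994].
-/

set_option linter.dupNamespace false
set_option autoImplicit false

noncomputable section

open scoped Classical AddSubgroup Polynomial

universe u

namespace Summit.BirchSwinnertonDyer.BirchSwinnertonDyer.Theorems.AlignedTransportAtTwoHalfDescentLayerIndexGrowthSelmer

open WeierstrassCurve Literature.NumberTheory.EllipticCurves Literature.NumberTheory.EllipticCurves.IwasawaDual
  Literature.NumberTheory.EllipticCurves.IwasawaAlgebra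
  Summit.BirchSwinnertonDyer.Rank1Residual.X1.MuLambda
  Summit.BirchSwinnertonDyer.Rank1Residual.X1.GeneratorBoundMu
  Summit.BirchSwinnertonDyer.Rank1Residual.Iwasawa
  Summit.BirchSwinnertonDyer.BirchSwinnertonDyer.Theorems.DefectPrime
  Summit.BirchSwinnertonDyer.BirchSwinnertonDyer.Theorems.AlignedTransportAtTwoCyclotomicLayerPrime
  Summit.BirchSwinnertonDyer.BirchSwinnertonDyer.Theorems.AlignedTransportAtTwoHalfDescentLayerIndex
  Summit.BirchSwinnertonDyer.BirchSwinnertonDyer.Theorems.AlignedTransportAtTwoHalfDescentLayerIndexSelmer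
  Summit.BirchSwinnertonDyer.BirchSwinnertonDyer.Theorems.AlignedTransportAtTwoHalfDescentLayerIndexCertificate
  Summit.BirchSwinnertonDyer.BirchSwinnertonDyer.Theorems.AlignedTransportAtTwoHalfDescentLayerIndexCertificateLayer
  Summit.BirchSwinnertonDyer.BirchSwinnertonDyer.Theorems.AlignedTransportAtTwoHalfDescentLayerIndexCriterion
  Summit.BirchSwinnertonDyer.BirchSwinnertonDyer.Theorems.AlignedTransportAtTwoHalfDescentLayerIndexBounded
  Summit.BirchSwinnertonDyer.BirchSwinnertonDyer.Theorems.AlignedTransportAtTwoHalfDescentLayerIndexGrowth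

/-! ## §1 Completeness of the growth-number certificate (module form) -/

section Module

variable {p : ℕ} [hp : Fact p.Prime] {M : Type u} [AddCommGroup M] [Module (IwasawaAlgebra p) M]

/-- ★★ **`μ(X) = 0 ⟺ ∃ n, 0 < g_n < p^{pⁿ(p−1)}`** (`g_n = #(ω_nX/ω_{n+1}X)`) for EVERY finitely generated torsion `Λ`-module `X`: the growth-number certificate is complete
(gen 55: `μ = 0 ⟺ ∃ n, 0 < #(X/Ψ_nX) < p^{pⁿ(p−1)}`, and `g_n ∣ #(X/Ψ_nX)`). [cite: Washington1997, §13.3 Thm. 13.13] [cite: GreenbergLNM1716, Conj. 1.11] -/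
theorem muInvariant_eq_zero_iff_exists_natCard_growth_pos_lt [Module.Finite (IwasawaAlgebra p) M] (hM : Module.IsTorsion (IwasawaAlgebra p) M) :
    muInvariant p M = 0 ↔ ∃ n : ℕ,
      0 < Nat.card (↥(Ideal.span {((1 + PowerSeries.X : PowerSeries ℤ_[p]) ^ (p ^ n) - 1 : IwasawaAlgebra p)} • ⊤ : Submodule (IwasawaAlgebra p) M) ⧸
          (Ideal.span {(((Polynomial.cyclotomic (p ^ (n + 1)) ℤ_[p]).comp (Polynomial.X + 1) : ℤ_[p][X]) : IwasawaAlgebra p)} • ⊤ :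
            Submodule (IwasawaAlgebra p) ↥(Ideal.span {((1 + PowerSeries.X : PowerSeries ℤ_[p]) ^ (p ^ n) - 1 : IwasawaAlgebra p)} • ⊤ :
              Submodule (IwasawaAlgebra p) M))) ∧
        Nat.card (↥(Ideal.span {((1 + PowerSeries.X : PowerSeries ℤ_[p]) ^ (p ^ n) - 1 : IwasawaAlgebra p)} • ⊤ : Submodule (IwasawaAlgebra p) M) ⧸
          (Ideal.span {(((Polynomial.cyclotomic (p ^ (n + 1)) ℤ_[p]).comp (Polynomial.X + 1) : ℤ_[p][X]) : IwasawaAlgebra p)} • ⊤ :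
            Submodule (IwasawaAlgebra p) ↥(Ideal.span {((1 + PowerSeries.X : PowerSeries ℤ_[p]) ^ (p ^ n) - 1 : IwasawaAlgebra p)} • ⊤ :
              Submodule (IwasawaAlgebra p) M))) < p ^ (p ^ n * (p - 1)) := by
  constructor
  · intro hμ
    obtain ⟨n, hpos, hlt⟩ := (muInvariant_eq_zero_iff_exists_natCard_layerQuotient_pos_lt hM).mp hμ
    obtain ⟨hgpos, hgle⟩ := natCard_growth_pos_and_le_of_natCard_layerQuotient_pos (p := p) (M := M) hpos
    exact ⟨n, hgpos, hgle.trans_lt hlt⟩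
  · rintro ⟨n, hpos, hlt⟩
    exact muInvariant_eq_zero_of_natCard_growth_pos_lt hM hpos hlt

end Module

/-! ## §2 Selmer currency -/

section Selmer

variable {K : Type u} [Field K] [NumberField K] (W : WeierstrassCurve K) {p : ℕ} [hp : Fact p.Prime] (κ : ZpExtension K p)
  {γ : Field.absoluteGaloisGroup K}

/-- **`#Sel_∞^{Γ_{n+1}} = #Sel_∞^{Γ_n} · g_n`** (`g_n = #(ω_nX/ω_{n+1}X)` the growth number of `X = X(E/K_∞)`), for EVERY Pontryagin-dual datum and every `n` — no torsion,
regularity or finite-submodule hypothesis (`Nat.card`). [cite: GreenbergLNM1716, §1 p. 65 and §3 p. 85] [cite: Washington1997, §13.3 (Lemma 13.18)] -/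
theorem natCard_selmerInvariants_succ_eq_mul_growth (hγ : κ.IsTopGenerator γ) (D : W.SelmerDualData κ γ) (n : ℕ) :
    Nat.card ↥(W.selmerInfty κ ⊓ W.layerInvariants κ (n + 1)) =
      Nat.card ↥(W.selmerInfty κ ⊓ W.layerInvariants κ n) *
        Nat.card (↥(Ideal.span {((1 + PowerSeries.X : PowerSeries ℤ_[p]) ^ (p ^ n) - 1 : IwasawaAlgebra p)} • ⊤ : Submodule (IwasawaAlgebra p) D.X) ⧸
          (Ideal.span {(((Polynomial.cyclotomic (p ^ (n + 1)) ℤ_[p]).comp (Polynomial.X + 1) : ℤ_[p][X]) : IwasawaAlgebra p)} • ⊤ :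
            Submodule (IwasawaAlgebra p) ↥(Ideal.span {((1 + PowerSeries.X : PowerSeries ℤ_[p]) ^ (p ^ n) - 1 : IwasawaAlgebra p)} • ⊤ :
              Submodule (IwasawaAlgebra p) D.X))) := by
  rw [← natCard_layerQuotient_omega_eq_natCard_selmerInvariants W κ hγ D (n + 1), ← natCard_layerQuotient_omega_eq_natCard_selmerInvariants W κ hγ D n]
  exact natCard_quotient_omega_succ_eq_mul_growth n

/-- ★★ **`p^{pⁿ(p−1)·μ(X(E/K_∞))} · #Sel_∞^{Γ_n} ∣ #Sel_∞^{Γ_{n+1}}`** for EVERY dual datum with `X` finitely generated torsion and every `n`: with `μ ≥ 1` the invariants of the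
limit Selmer group are multiplied by AT LEAST `p^{pⁿ(p−1)}` at every step of the tower (when finite). [cite: GreenbergLNM1716, Thm. 1.10 and Conj. 1.11]
[cite: Washington1997, §13.3 Thm. 13.13] -/
theorem pow_mul_natCard_selmerInvariants_dvd_succ (hγ : κ.IsTopGenerator γ) (D : W.SelmerDualData κ γ) [Module.Finite (IwasawaAlgebra p) D.X]
    (hD : D.IsTorsion) (n : ℕ) :
    p ^ (p ^ n * (p - 1) * D.mu) * Nat.card ↥(W.selmerInfty κ ⊓ W.layerInvariants κ n) ∣ Nat.card ↥(W.selmerInfty κ ⊓ W.layerInvariants κ (n + 1)) := by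
  rw [← natCard_layerQuotient_omega_eq_natCard_selmerInvariants W κ hγ D (n + 1), ← natCard_layerQuotient_omega_eq_natCard_selmerInvariants W κ hγ D n]
  exact pow_mul_natCard_dvd_natCard_quotient_omega_succ (M := D.X) hD n

/-- ★★ **Up the tower: `p^{(pⁿ−1)·μ} · #Sel_∞^{Γ} ∣ #Sel_∞^{Γ_n}`** (`Γ = Γ_0`), every dual datum with `X` f.g. torsion. [cite: GreenbergLNM1716, Thm. 1.10]
[cite: Washington1997, §13.3 Thm. 13.13] -/
theorem pow_mul_natCard_selmerInvariants_zero_dvd (hγ : κ.IsTopGenerator γ) (D : W.SelmerDualData κ γ) [Module.Finite (IwasawaAlgebra p) D.X]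
    (hD : D.IsTorsion) (n : ℕ) :
    p ^ ((p ^ n - 1) * D.mu) * Nat.card ↥(W.selmerInfty κ ⊓ W.layerInvariants κ 0) ∣ Nat.card ↥(W.selmerInfty κ ⊓ W.layerInvariants κ n) := by
  rw [← natCard_layerQuotient_omega_eq_natCard_selmerInvariants W κ hγ D n, ← natCard_layerQuotient_omega_eq_natCard_selmerInvariants W κ hγ D 0,
    pow_zero, pow_one, add_sub_cancel_left]
  exact pow_mul_natCard_dvd_natCard_quotient_omega (M := D.X) hD n

/-- ★★★ **`μ(X(E/K_∞)) = 0` FROM ONE STEP OF SUB-MAXIMAL GROWTH.** `E/K`, `κ` any `ℤ_p`-extension with topological generator `γ`, `D` any Pontryagin-dual datum with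
`X` finitely generated torsion. If at SOME `n`: **`0 < #Sel_{p^∞}(E/K_∞)^{Γ_{n+1}} < p^{pⁿ(p−1)} · #Sel_{p^∞}(E/K_∞)^{Γ_n}`**, then **`μ(X) = 0`** — no structure theorem at
the layer, no `λ`, no «no finite submodule» hypothesis, no exact count. [cite: GreenbergLNM1716, Conj. 1.11 and §1 pp. 60–65] [cite: Washington1997, §13.3 Thm. 13.13] -/
theorem mu_eq_zero_of_natCard_selmerInvariants_succ_pos_lt_mul (hγ : κ.IsTopGenerator γ) (D : W.SelmerDualData κ γ)
    [Module.Finite (IwasawaAlgebra p) D.X] (hD : D.IsTorsion) {n : ℕ} (hpos : 0 < Nat.card ↥(W.selmerInfty κ ⊓ W.layerInvariants κ (n + 1)))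
    (hlt : Nat.card ↥(W.selmerInfty κ ⊓ W.layerInvariants κ (n + 1)) < p ^ (p ^ n * (p - 1)) * Nat.card ↥(W.selmerInfty κ ⊓ W.layerInvariants κ n)) :
    D.mu = 0 := by
  rw [← natCard_layerQuotient_omega_eq_natCard_selmerInvariants W κ hγ D (n + 1)] at hpos hlt
  rw [← natCard_layerQuotient_omega_eq_natCard_selmerInvariants W κ hγ D n] at hlt
  exact muInvariant_eq_zero_of_natCard_quotient_omega_succ_pos_lt_mul (M := D.X) hD hpos hlt

/-- Gen 55's invariants certificate is the special case: `0 < #Sel_∞^{Γ_{n+1}} < p^{pⁿ(p−1)}` forces `#Sel_∞^{Γ_n} ≥ 1` and hence the ratio inequality.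
[cite: GreenbergLNM1716, Conj. 1.11] -/
theorem natCard_selmerInvariants_succ_lt_mul_of_lt (hγ : κ.IsTopGenerator γ) (D : W.SelmerDualData κ γ) {n : ℕ}
    (hpos : 0 < Nat.card ↥(W.selmerInfty κ ⊓ W.layerInvariants κ (n + 1)))
    (hlt : Nat.card ↥(W.selmerInfty κ ⊓ W.layerInvariants κ (n + 1)) < p ^ (p ^ n * (p - 1))) :
    Nat.card ↥(W.selmerInfty κ ⊓ W.layerInvariants κ (n + 1)) < p ^ (p ^ n * (p - 1)) * Nat.card ↥(W.selmerInfty κ ⊓ W.layerInvariants κ n) := by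
  have h := natCard_selmerInvariants_succ_eq_mul_growth W κ hγ D n
  rw [h] at hpos
  obtain ⟨hn, -⟩ := CanonicallyOrderedAdd.mul_pos.mp hpos
  exact hlt.trans_le (Nat.le_mul_of_pos_right _ hn)

/-- ★★ **COMPLETENESS IN A RANK-`0` TOWER.** Same setting, `char_Λ X = (f)` with `f(0) ≠ 0` and `Ψ_m ∤ f` for all `m` (every `#Sel_∞^{Γ_n}` finite). Then
**`μ(X) = 0 ⟺ ∃ n, 0 < #Sel_∞^{Γ_{n+1}} < p^{pⁿ(p−1)} · #Sel_∞^{Γ_n}`**. [cite: GreenbergLNM1716, Thm. 1.10 and Conj. 1.11] [cite: Washington1997, §13.3 Thm. 13.13] -/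
theorem mu_eq_zero_iff_exists_natCard_selmerInvariants_succ_pos_lt_mul (hγ : κ.IsTopGenerator γ) (D : W.SelmerDualData κ γ)
    [Module.Finite (IwasawaAlgebra p) D.X] (hD : D.IsTorsion) {f : IwasawaAlgebra p} (hchar : D.charIdeal = Ideal.span {f})
    (h0 : PowerSeries.constantCoeff f ≠ 0) (hΨ : ∀ m, ¬ ((((Polynomial.cyclotomic (p ^ (m + 1)) ℤ_[p]).comp (Polynomial.X + 1) : ℤ_[p][X]) : IwasawaAlgebra p) ∣ f)) :
    D.mu = 0 ↔ ∃ n : ℕ, 0 < Nat.card ↥(W.selmerInfty κ ⊓ W.layerInvariants κ (n + 1)) ∧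
      Nat.card ↥(W.selmerInfty κ ⊓ W.layerInvariants κ (n + 1)) < p ^ (p ^ n * (p - 1)) * Nat.card ↥(W.selmerInfty κ ⊓ W.layerInvariants κ n) := by
  obtain ⟨hiff, hmu⟩ := mu_eq_zero_iff_exists_natCard_selmerInvariants_pos_lt W κ hγ D hD hchar h0 hΨ
  constructor
  · intro hμ
    rw [hmu] at hμ
    obtain ⟨n, hpos, hlt⟩ := hiff.mp hμ
    exact ⟨n, hpos, natCard_selmerInvariants_succ_lt_mul_of_lt W κ hγ D hpos hlt⟩
  · rintro ⟨n, hpos, hlt⟩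
    exact mu_eq_zero_of_natCard_selmerInvariants_succ_pos_lt_mul W κ hγ D hD hpos hlt

/-! ## §3 Finite level: two consecutive layers of finite-level data -/

/-- ★★★ **`μ = 0` FROM FINITE-LEVEL ORDERS AT TWO CONSECUTIVE LAYERS.** Same setting; `Sel_m = Sel_{p^∞}(E/K_m)`, `ker g_m = A_m/Sel_m` (Greenberg's control kernel, tree
`KerG`), `ker h_m` the kernel of `Sel_m → Sel_∞^{Γ_m}` (tree `layerToInfty`). If at SOME `n`:
**`0 < #Sel_{n+1}·#ker g_{n+1}`** and **`#Sel_{n+1} · #ker g_{n+1} · #ker h_n < p^{pⁿ(p−1)} · #Sel_n · #ker g_n`**, then **`μ(X(E/K_∞)) = 0`** (Lemma 4.3 at `n` and `n+1`: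
`#Sel_∞^{Γ_m}·#ker h_m = #Sel_m·#ker g_m`). [cite: GreenbergLNM1716, §4 Lemma 4.3 (p. 103), §3 Lemmas 3.1–3.3, Conj. 1.11] [cite: Mazur1972, §6] -/
theorem mu_eq_zero_of_natCard_selmerLayer_succ_mul_lt_mul (hγ : κ.IsTopGenerator γ) (D : W.SelmerDualData κ γ) [Module.Finite (IwasawaAlgebra p) D.X]
    (hD : D.IsTorsion) {n : ℕ} (hpos : 0 < Nat.card ↥(W.selmerLayer κ (n + 1)) * Nat.card (W.KerG κ (n + 1)))
    (hlt : Nat.card ↥(W.selmerLayer κ (n + 1)) * Nat.card (W.KerG κ (n + 1)) * Nat.card (W.layerToInfty κ n).ker <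
      p ^ (p ^ n * (p - 1)) * (Nat.card ↥(W.selmerLayer κ n) * Nat.card (W.KerG κ n))) : D.mu = 0 := by
  have h43s := W.natCard_selmerInvariants_mul_natCard_ker_layerToInfty κ (n + 1)
  have h43n := W.natCard_selmerInvariants_mul_natCard_ker_layerToInfty κ n
  set a₁ := Nat.card ↥(W.selmerInfty κ ⊓ W.layerInvariants κ (n + 1)) with ha₁
  set a₀ := Nat.card ↥(W.selmerInfty κ ⊓ W.layerInvariants κ n) with ha₀
  set k₁ := Nat.card (W.layerToInfty κ (n + 1)).ker with hk₁
  set k₀ := Nat.card (W.layerToInfty κ n).ker with hk₀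
  -- positivity
  rw [← h43s] at hpos
  obtain ⟨ha₁pos, hk₁pos⟩ := CanonicallyOrderedAdd.mul_pos.mp hpos
  have hk₀pos : 0 < k₀ := by
    refine Nat.pos_of_ne_zero fun hk ↦ ?_
    have hrhs : 0 < p ^ (p ^ n * (p - 1)) * (Nat.card ↥(W.selmerLayer κ n) * Nat.card (W.KerG κ n)) := lt_of_le_of_lt (Nat.zero_le _) hlt
    rw [← h43n, hk, mul_zero, mul_zero] at hrhs
    exact lt_irrefl 0 hrhs
  -- `a₁·k₁·k₀ < p^φ·a₀·k₀`, cancel `k₀`, drop `k₁ ≥ 1`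
  rw [← h43s, ← h43n] at hlt
  have h1 : a₁ * k₁ < p ^ (p ^ n * (p - 1)) * a₀ := by
    rw [← mul_assoc] at hlt
    exact Nat.lt_of_mul_lt_mul_right hlt
  have h2 : a₁ < p ^ (p ^ n * (p - 1)) * a₀ := (Nat.le_mul_of_pos_right _ hk₁pos).trans_lt h1
  exact mu_eq_zero_of_natCard_selmerInvariants_succ_pos_lt_mul W κ hγ D hD ha₁pos h2

/-- The sharper form with the torsion kernels counted: when `E(K_∞)[p^∞]` is finite, `#ker h_m = #E[p^∞]^{Gal(K̄/K_m)}` (tree), and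
**`0 < #Sel_{n+1}·#ker g_{n+1}`, `#Sel_{n+1}·#ker g_{n+1}·#E[p^∞]^{Gal(K̄/K_n)} < p^{pⁿ(p−1)}·#Sel_n·#ker g_n·#E[p^∞]^{Gal(K̄/K_{n+1})}` ⟹ `μ(X(E/K_∞)) = 0`**.
[cite: GreenbergLNM1716, §4 Lemma 4.3 (p. 103)] -/
theorem mu_eq_zero_of_natCard_selmerLayer_succ_mul_lt_mul_fixedPoints (hγ : κ.IsTopGenerator γ) (D : W.SelmerDualData κ γ)
    [Module.Finite (IwasawaAlgebra p) D.X] [Finite (FixedPoints.addSubgroup κ.kerSubgroup (geomPrimaryTorsion W p))] (hD : D.IsTorsion) {n : ℕ}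
    (hpos : 0 < Nat.card ↥(W.selmerLayer κ (n + 1)) * Nat.card (W.KerG κ (n + 1)))
    (hlt : Nat.card ↥(W.selmerLayer κ (n + 1)) * Nat.card (W.KerG κ (n + 1)) * Nat.card {m : geomPrimaryTorsion W p | ∀ σ ∈ κ.layerSubgroup n, σ • m = m} <
      p ^ (p ^ n * (p - 1)) * (Nat.card ↥(W.selmerLayer κ n) * Nat.card (W.KerG κ n)) *
        Nat.card {m : geomPrimaryTorsion W p | ∀ σ ∈ κ.layerSubgroup (n + 1), σ • m = m}) : D.mu = 0 := by
  have h43s := W.natCard_selmerInvariants_mul_natCard_ker_layerToInfty κ (n + 1)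
  have h43n := W.natCard_selmerInvariants_mul_natCard_ker_layerToInfty κ n
  rw [W.natCard_ker_layerToInfty_eq_natCard_fixedPoints κ (n + 1)] at h43s
  rw [W.natCard_ker_layerToInfty_eq_natCard_fixedPoints κ n] at h43n
  set a₁ := Nat.card ↥(W.selmerInfty κ ⊓ W.layerInvariants κ (n + 1)) with ha₁
  set a₀ := Nat.card ↥(W.selmerInfty κ ⊓ W.layerInvariants κ n) with ha₀
  set t₁ := Nat.card {m : geomPrimaryTorsion W p | ∀ σ ∈ κ.layerSubgroup (n + 1), σ • m = m} with ht₁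
  set t₀ := Nat.card {m : geomPrimaryTorsion W p | ∀ σ ∈ κ.layerSubgroup n, σ • m = m} with ht₀
  rw [← h43s] at hpos
  obtain ⟨ha₁pos, ht₁pos⟩ := CanonicallyOrderedAdd.mul_pos.mp hpos
  have ht₀pos : 0 < t₀ := by
    refine Nat.pos_of_ne_zero fun ht ↦ ?_
    have hrhs : 0 < p ^ (p ^ n * (p - 1)) * (Nat.card ↥(W.selmerLayer κ n) * Nat.card (W.KerG κ n)) * t₁ := lt_of_le_of_lt (Nat.zero_le _) hlt
    rw [← h43n, ht, mul_zero, mul_zero, zero_mul] at hrhs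
    exact lt_irrefl 0 hrhs
  rw [← h43s, ← h43n] at hlt
  -- `a₁ t₁ t₀ < p^φ a₀ t₀ t₁` ⟹ `a₁ < p^φ a₀`
  have h1 : a₁ * (t₁ * t₀) < p ^ (p ^ n * (p - 1)) * a₀ * (t₁ * t₀) := by
    calc a₁ * (t₁ * t₀) = a₁ * t₁ * t₀ := by ring
      _ < p ^ (p ^ n * (p - 1)) * (a₀ * t₀) * t₁ := hlt
      _ = p ^ (p ^ n * (p - 1)) * a₀ * (t₁ * t₀) := by ring
  have h2 : a₁ < p ^ (p ^ n * (p - 1)) * a₀ := Nat.lt_of_mul_lt_mul_right h1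
  exact mu_eq_zero_of_natCard_selmerInvariants_succ_pos_lt_mul W κ hγ D hD ha₁pos h2

end Selmer

end Summit.BirchSwinnertonDyer.BirchSwinnertonDyer.Theorems.AlignedTransportAtTwoHalfDescentLayerIndexGrowthSelmer

end
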